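import Literature.NumberTheory.EllipticCurves.KellerYin2024.AnomalousAnticyclotomicMainConjecture
import Literature.NumberTheory.EllipticCurves.KellerYin2024.AnticyclotomicLocalEulerFactors
import Literature.NumberTheory.EllipticCurves.KellerYin2024.LatticeCharacters
import Literature.NumberTheory.EllipticCurves.CastellaGrossiLeeSkinner2022.KatzPAdicLFunctionFrame
import HarnessLib

/-!
# Keller–Yin Thm. 1.5.1 (`algmain`) and Castella–Grossi–Lee–Skinner / Keller–Yin Thm. 2.2.2
# (`anacong`) at an ANOMALOUS Eisenstein prime, weight 2: the `λ`-invariant of the good lattice's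
# anticyclotomic Selmer group, resp. of its BDP `p`-adic `L`-function, in terms of the two RESIDUAL
# CHARACTERS — the algebraic and analytic halves INSIDE `stub_muLambda`, typed as named statements

Cell `bsd-eis` (FULL-BSD rank ≤ 1 programme, home `run/shared/lean/pub/bsd-eis/`), seat
`bsd-eis-k5-ty` (D-0074 group (C) row E (ii); interface agreed with seat `bsd-eis-k5-c2` on the cell
bus, STATUS 2026-08-26 02:22:42Z / 02:55:28Z). The K5 route's crux 2 `GoodLatticeBDPValue`
(stmt-BirchSwinnertonDyer-19032) is in the kernel modulo ONE non-fact stub,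
`X1.KellerYinIMC2Halves.GoodLatticeMuLambdaOnTree` = "`μ(𝔛_E) = μ(𝓛_E) = 0` and `λ(𝔛_E) = λ(𝓛_E)`
at the good lattice of an anomalous Eisenstein prime" = Keller–Yin arXiv:2402.12781v2 Thm. 1.5.1
(`algmain`) + Thm. 2.2.3 (`anacomp`), i.e. the anomalous case of CGLS Thm. 2.2.4 (`mulambda`).
Typing Thm. 2.2.3 itself as a named fact would RESTATE the stub (k5-c2, 02:22:42Z; D-0014 (e)).
The honest cut goes THROUGH the two characters `ω̃` (on the rational line) and `𝟙̃` (on the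
quotient) of `E[p]`: KY's printed proof of Thm. 3.0.8 (TeX L1631–1640) is
  [ALG] Thm. 1.5.1: `μ(𝔛_f) = 0`, `λ(𝔛_f) [+1] = λ(𝔛_{ω̃}) + λ(𝔛_{𝟙̃}) + Σ_{w∈S} {λ𝒫_w(ω̃) + λ𝒫_w(𝟙̃) − λ𝒫_w(f)}` (PREPRINT — the anomalous algebraic comparison, KY's NEW content),
  [AN]  Thm. 2.2.2: `μ(𝓛_f) = 0`, `λ(𝓛_f) = λ(𝓛_φ) + λ(𝓛_ψ) + Σ_{w∈S} {…}` (PUBLISHED = CGLS Thm. 2.2.2 for `φ ≠ 𝟙`; KY's extension to `φ = 𝟙`),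
  [BR]  the one-variable CM main conjectures per character (Rubin 1991 + CW78 / de Shalit III.1.10 / Yager + Hida 2010) — NOT typed here (see "What is NOT here").
This file types [ALG] and [AN] over the landed vocabulary (`CharacterSelmerGroups.lean` p414770,
`AnticyclotomicLocalEulerFactors.lean` (D3), `KatzPAdicLFunctionFrame.lean` p415953, `IsBDPLFunction`,
`AcSelmer.XAc`), plus two DEFINITIONS linking the characters to `E[p]` and to a Hecke character.
Nothing is proved about `E`; the four named statements are HYPOTHESES BY NAME (D-0014), two of them
preprint claims (`_OPEN`, `[claim: KellerYin2024, status: under-review]`); the fourth,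
`thm222_anacong_goodLattice_of_five_le` (§2b), is the `5 ≤ p` slice of [AN] as a COMPOSITION OF
REFEREED PRINT (CGLS 2022 ∘ Kriz 2016 Rem. 33 ∘ Hida 2010; ARM P referee C3, REFEREE.md R428 OPTION B,
2026-08-27; D-AUDIT-r13-Q15-Kriz16-CGLS22.md 63212b7a93cbaeba §4(a)/§6), with its two PROVED bridges.

## Sources (TeX of record `HOME/lit/src/ky24-v2/main.tex`; CGLS = `…/cgls22-v2final/Eisenstein.tex`)

* KY §1 standing (L365–385): `f` new of weight `2r`, trivial character; "Fix an odd prime `p ∤ N`";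
  `K` imaginary quadratic, `p = v v̄` split, `v` induced by `ι_p`; Heegner hypothesis "every prime
  `ℓ ∣ N` splits in `K`" (L379–381); `Frob_w` ARITHMETIC (L383); `Γ` anticyclotomic, `Λ = 𝓞⟦Γ⟧`,
  `T = γ − 1` (L385). §1.4 (L1066–1083): `ρ̄_f^{ss} ≅ 𝔽(φ) ⊕ 𝔽(ψ)`, `0 → 𝔽(φ) → ρ̄_f → 𝔽(ψ) → 0`,
  `φψ = ω`; "we are free to assume `φ|_{G_p} = ω` and `ψ|_{G_p} = 𝟙`" (the GOOD LATTICE, Prop. 1.3.1);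
  "we could always assume `H⁰(K, ρ̄_f) = 0` … We will do so in the rest of this paper" (L1083).
  𝔛_f, 𝔛_f^S = duals of the unramified Selmer groups of `f` (L1085); `𝒫_w(f) := P_w(ℓ⁻¹γ_w)`,
  `P_w = det(1 − Frob_w X ∣ V_{f,I_w})` (L1337–1341).
* **KY Thm. 1.5.1** (`algmain`, L1346–1357; PDF p. 30±1): "Assume that `φ|_{G_p} = ω` and
  `φ|_{G_K} ≠ ω`. Then the module `𝔛_f` is `Λ`-torsion with `μ(𝔛_f) = 0` and
  `λ(𝔛_f) = λ(𝔛_φ) + λ(𝔛_ψ) + Σ_{w∈S} {λ(𝒫_w(φ)) + λ(𝒫_w(ψ)) − λ(𝒫_w(f))}`. In the case where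
  `φ|_{G_K} = ω`, the same results hold except that the relation between `Λ`-invariants now becomes
  `λ(𝔛_f) + 1 = λ(𝔛_φ) + λ(𝔛_ψ) + Σ_{w∈S} {…}`." Proof: "With our Thm. 1.4.1 and Rem. 1.4.2, the
  proof is the same as that of [CGLS, Theorem 1.5.1]." (`𝔛_θ = H¹_{𝓕_nr}(K, M_θ)^∨`, L713–717;
  `S = Σ ∖ {v, v̄, ∞}`, `Σ ⊇ {∞} ∪ {w ∣ p N}`, all finite places of `Σ` split, L639.)
* **CGLS Thm. 2.2.2** (`cor:Kriz`, Invent. Math. 227 (2022); TeX L1124–1129): "Assume that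
  `E[p]^{ss} = 𝔽_p(φ) ⊕ 𝔽_p(ψ)` as `G_ℚ`-modules, with the characters `φ, ψ` labeled so that
  `p ∤ cond(φ)`, and suppose `φ ≠ 𝟙`. Then `μ(𝓛_E) = 0` and
  `λ(𝓛_E) = λ(𝓛_φ) + λ(𝓛_ψ) + Σ_{w∈S} {λ(𝒫_w(φ)) + λ(𝒫_w(ψ)) − λ(𝒫_w(E))}`", with, IN ITS PROOF
  (L1148–1151, display (2.16) `eq:functional`): "since `ψ = φ⁻¹ω`, the functional equation for the
  Katz `p`-adic `L`-function (see e.g. [Kri16, Thm. 27]) yields `λ(𝓛_ψ) = λ(𝓛_φ)`", and (L1132)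
  "the vanishing of `μ(𝓛_E)` follows immediately from the congruence of Theorem 2.2.1 and Hida's
  result [Hida 2010]" (so `μ(𝓛_φ) = 0` is used). NO hypothesis `φ|_{G_p} ≠ 𝟙, ω` in Thms. 2.2.1/2.2.2
  (that hypothesis enters CGLS only at Thm. 2.2.4 through the algebraic side). Standing (§2, L940–
  958; Thm. 2.1.1): `p > 2`, `p = v v̄` split, `K` with (Heeg) and `D_K` odd `≠ −3` (BDP), `𝓛_E` the
  BDP `p`-adic `L`-function, `𝓛_θ` the Katz `p`-adic `L`-function of Thm. 2.1.2 for `θ` of conductor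
  `C ∣ N`, `p ∤ C` — so `𝓛_φ` IS in the scope of the tree's frame `IsKatzLFunction` (p415953) while
  `𝓛_ψ` (`ψ` ramified at `p`) is NOT; this is why (2.16) is folded into the typed statement
  (`2·λ(𝓛_φ)`), never a second Katz witness.
* **KY Thm. 2.2.2** (`anacong`, L1445–1448): the same statement WITHOUT "`φ ≠ 𝟙`" ("labeled so that
  `p ∤ cond(φ)`. Then `μ(𝓛_f) = 0` and `λ(𝓛_f) = λ(𝓛_φ) + λ(𝓛_ψ) + Σ_{w∈S} {…}`"), obtained "as in
  [CGLS]" from KY Thm. 2.2.1, whose proof (L1426–1427) adds: "when `φ|_{G_K} ≠ 𝟙`, we always have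
  full Eisenstein descent by [Kri16]. If `φ|_{G_K} = 𝟙`, we would only get partial Eisenstein descent
  in some cases. However, the proof in [CGLS] essentially only requires partial Eisenstein descent
  because only the constant term of `G` … can be different and the `p`-depletion of `G` does not see
  the constant term." — an ARGUMENT of the preprint (PRE), load-bearing exactly for `E[p]^{ss} =
  𝟙 ⊕ ω` (row A1 "case (a)", 1 438 of the 1 487 type-A census classes; "case (b)" `𝟙̃ = ε ≠ 𝟙`,
  49 classes, is inside CGLS Thm. 2.2.2).

## Dictionary (E/ℚ, weight 2; the binders COMMON to all three statements are VERBATIM those of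
## `thm308_imc2_bdpValue_goodLattice_OPEN` / `X1.KellerYinHalves.GoodLatticeMuLambdaOnTree`)

* `W` globally minimal elliptic over `ℚ`; `2 < p`, `Good W p` ("odd `p ∤ N`"), `Red W p`, `Anom W p`
  and the good-lattice normalisation `∀ Φ, IsRationalLine W p Φ → ¬ LineUnramifiedAt W p Φ`
  ("`φ|_{G_p} = ω`, `ψ|_{G_p} = 𝟙`": the rational line is the RAMIFIED one; `AnomalousAnticyclotomicMainConjecture.lean`);
  `K` imaginary quadratic with (Heeg) for `N_E` and for `p` (= `p` split); `E(K)[p] = 0`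
  (KY's standing `H⁰(K, ρ̄_f) = 0`, L1083); `ι : K →+* ℚ_p` inducing `v`, `vbar ∋ p`, `vbar ≠ v`;
  `κ` anticyclotomic, `γ` a topological generator (`[Fact (κ.IsTopGenerator γ)]`).
* THE TWO CHARACTERS as data, AT `K`-LEVEL (interface agreed with the consumer seat bsd-eis-k5-c2,
  STATUS 02:59:41Z / 03:20:27Z): `θsub θquot : FramedGaloisRep K 𝒪 1`, `𝒪 = padicCoeffIntegers ∅ ⊆ ℚ̄_p`
  (`= 𝒪_{ℚ_p(∅)} ≅ ℤ_p`: the coefficient ring is PINNED to `ℤ_p` because the tree's `lambdaInvariant p`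
  is a `ℚ_p`-dimension over `Λ_{ℤ_p}` — over a bigger `𝒪` it would be `[F:ℚ_p]·λ_𝒪`), linked to `E[p]`
  by the DEFINITION `IsResidualPairOver (W.baseChange K) p θsub θquot` below: both are Teichmüller
  (`θ^{p−1} = 1`) and there is a `Γ_K`-stable subgroup `Φ ≤ E[p](K̄)` of order `p` on which `Γ_K`
  acts through `θsub mod 𝔭` and on `E[p]/Φ` through `θquot mod 𝔭` — i.e. `θsub = φ|_{G_K} = ω̃`,
  `θquot = ψ|_{G_K} = 𝟙̃` in KY's labelling (§1.4 display `char to f`, L1079; the Selmer groups, the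
  local factors and the Katz `L`-function only see the restrictions to `G_K`), `θquot` = the
  `p`-UNRAMIFIED character = CGLS's `φ`, `θsub` = CGLS's `ψ` in the labelling of Thm. 2.2.2.
  KY's case distinction "`φ|_{G_K} = ω`" ⟺ "`ψ|_{G_K} = 𝟙`" ⟺ `∀ σ, θquot σ = 1`; CGLS's
  hypothesis "`φ ≠ 𝟙`" (on `G_ℚ`) is implied by the `K`-level `¬ ∀ σ, θquot σ = 1` used in the
  PUBLISHED analytic statement below (which thereby also excludes, harmlessly, `φ = ε_K`; KY's own
  descent caveat, L1427, is phrased on `φ|_{G_K}`).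
* `𝔛_f` ↦ the tree's `Castella2018.AcSelmer.XAc (W.baseChange K) p κ vbar ∅ γ` (= CGLS's
  `𝔛_E = H¹_{𝓕_Gr}(K, M_E)^∨`: strict at `v̄`, relaxed at `v`, trivial at `w ∤ p` — for `E[p^∞]` the
  same as unramified at `w ∤ p` by the Weil bound, LIT-DOSSIER §35 (B′)). KY's `𝔛_f` is the
  `𝓕_nr`-dual (unramified at `v̄`); the two "generate the same characteristic ideals" (KY proof of
  Thm. 3.0.8, L1631–1634; the kernel of `H¹_{𝓕_Gr} → H¹_{𝓕_nr}` is controlled by the finite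
  `ker(res_{M_f})`, KY Lemma 1.3.6 `kerresf` / L1105–1108), so `μ`, `λ` and torsion-ness agree —
  the statements below are made for the tree's object, which is what the consumer holds.
* `𝔛_θ` (`θ ∈ {θsub, θquot}`) ↦ ANY `GreenbergVatsal2000.DatumDualData κ γ (charModule ∅ θ)
  (bdpData _ p vbar) ∅` = the `Λ`-dual of `unrSelmer κ (charModule ∅ θ) vbar ∅` = `H¹_{𝓕_nr}(K, M_θ)^∨`
  (p414770; exists, `nonempty_unrDualData_char`; unique up to isomorphism). `μ`, `λ` ↦
  `muInvariant p`, `lambdaInvariant p` (IwasawaAlgebra.lean; Washington §13.2).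
* `λ(𝒫_w(θ))`, `λ(𝒫_w(f))` ↦ `charLocalLambda ∅ κ θ w`, `curveLocalLambda κ (W.baseChange K) w` (D3).
  `S` ↦ a `Finset` `Sf` of places of `K` with the DEFINITE membership `w ∈ Sf ↔ N_E ∈ w` (the primes
  of `K` over `ℓ ∣ N`, all split by (Heeg); KY's `S` may contain further split places `∤ p`, which
  contribute `λ𝒫_w(φ) + λ𝒫_w(ψ) − λ𝒫_w(f) = 0`). NO `ℕ`-SUBTRACTION: the identities carry
  `Σ λ𝒫_w(f)` on the LEFT.
* `𝓛_f` ↦ every frame `(ι', Ω_K ≠ 0, Ω_p ∈ R₀ˣ, L)` with `IsBDPLFunction ι' v κ γ Dt.f Ω_K Ω_p L`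
  exactly as in `GoodLatticeMuLambdaOnTree` (Castella's normalisation; any two frames of the same data
  generate the same ideal of `R₀⟦T⟧` — tree `X11b.R1.span_singleton_eq_of_isBDPLFunction` — so `μ`,
  `λ` do not depend on the periods; CGLS's own constants differ from Castella's by a unit of `Λ^{ur}`
  composed with `(1+T) ↦ u(1+T)`, LIT-DOSSIER §36 (C′) — immaterial in `μ/λ` currency, which is why
  [AN] is typed in that currency, "(β)").
  `𝓛_φ` ↦ every `Lφ` with `IsKatzLFunction ι' v vbar Cbar κ γ θK Ω_K′ Ω_p′ Lφ` (p415953) for THE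
  finite-order Hecke character `θK` of `K` attached to `θquot` by ARITHMETIC reciprocity
  (`IsHeckeCharOf ι' θquot θK` below: `θK(ϖ_w) = ι'(θquot(Frob_w^{arith}))` — CGLS's
  `θ_K = θ ∘ Nm`, "`θ(p) = θ_K(ϖ_v)`"; NB the tree's `IsPAdicAvatarOf` is the GEOMETRIC dictionary and
  would attach `θ⁻¹`), with ITS OWN period binders `(Ω_K′ ≠ 0, Ω_p′ ∈ R₀ˣ)` — the Katz period
  `Ω_∞` is `2πi` times the BDP period `Ω_K` of the tree's Castella-normalised frame (KY Rem. 2.1.2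
  `compperiods`; CGS Rem. 2.3.2), so SHARED binders would be off by `(2πi)^{2n}` at `T`-degree `n`; in
  `μ/λ` currency each frame is quantified universally and independently (the witnesses of one frame
  generate one ideal of `R₀⟦T⟧`) — and `Cbar` any finite set of places at which `θK` is RAMIFIED
  (then the away-from-`p` factor is `1`, `katzAwayFactor_eq_one_of_forall_not_isUnramifiedAt` —
  CGLS's exact-conductor convention). `μ = 0 ∧ λ = n` for `L ∈ R₀⟦T⟧` ↦ `FirstUnitCoeffAt L n` (first unit
  coefficient at index `n`; Weierstrass preparation over `R₀ = W(𝔽̄_p)`, Washington §7.1).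

## What is NOT here (honest gaps in the typed inputs, recorded for the planner / k5-c2)

* [BR] the per-character main conjectures `λ(𝔛_θ) = λ(𝓛_θ) + [θ|_{G_K} = 𝟙]`, `μ = 0` (KY Thm. 1.2.2
  ¶2 + proof of Thm. 2.2.3, L1455–1467; CGLS Thm. 1.2.2 / proof of Thm. 2.2.4): typable over p415953
  for `θ = 𝟙̃` (unramified at `p`); for `θ = ω̃` (ramified at `v`, `v̄`) the landed Katz frame is NOT
  faithful (Kriz Thm. 27 carries `Local_𝔭(χ) ≠ 1` for `χ` ramified at `𝔭`) and CGLS themselves pass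
  through (2.16). Left to a successor / to the consumer's Summits-side stubs.
* KY Prop. 1.2.5 (`S`-imprimitive character formula), Thm. 1.2.2 (torsion, `μ = 0` of `𝔛_θ`) —
  internal to the proof of Thm. 1.5.1; Thm. 2.2.1 (the congruence itself — needs a CGLS-normalised
  BDP twin frame, §36 (C′) "(α)"); Thm. 2.2.3 (= the stub).
* Any proof. `GoodLatticeMuLambdaOnTree ⇐ [ALG] ∧ [AN] ∧ [BR]` is the consumer's kernel glue
  (k5-c2, `--supports stmt-BirchSwinnertonDyer-19032`), with the dictionary `μ(X) = 0 ∧ λ(X) = n ∧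
  char X = (F) ⇒ FirstUnitCoeffAt (map F) n` proved in the tree (`X1.MuPart`, `X1.ParitySqueeze`).

## References
* [KellerYin2024] arXiv:2402.12781v2: Thm. 1.5.1 (L1346–1357), §1.4 (L1066–1083), §1 standing
  (L365–385), Lemma 1.3.6, Thm. 2.2.1 proof (L1426–1427), Thm. 2.2.2 (L1445–1448), proof of Thm. 3.0.8
  (L1631–1640).
* [CastellaGrossiLeeSkinner2022] Invent. Math. 227 (2022): Thm. 2.2.2 (`cor:Kriz`, L1124–1153) with
  (2.16); Thm. 2.1.2 (L1015–1041); Thm. 1.5.1 (`MAINalgside`, L909); §1.2 (L593–620).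
* [Hida2010MuInvariant] (μ = 0 of anticyclotomic Katz L-functions, as used in CGLS L1132); [Kriz2016] Thm. 27.
* HOME/LIT-DOSSIER.md §35 (A)/(B′), §36 (B)(C)(C′); HOME/bsd-eis-ky-MEMO-1.md §3 (3A′/3B/3R).
-/

set_option autoImplicit false

noncomputable section

open scoped Classical

open WeierstrassCurve NumberField IsDedekindDomain Field Polynomial
  Literature.NumberTheory.EllipticCurves Literature.NumberTheory.EllipticCurves.ModularForms
  Literature.NumberTheory.QuadraticFields Literature.NumberTheory.EllipticCurves.Rank1Residual
  Literature.NumberTheory.EllipticCurves.Castella2018 Literature.NumberTheory.EllipticCurves.GreenbergSelmer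
  Literature.NumberTheory.EllipticCurves.GreenbergVatsal2000 Literature.NumberTheory.GaloisRepresentations
  Literature.NumberTheory.EllipticCurves.CastellaGrossiLeeSkinner2022

namespace Literature.NumberTheory.EllipticCurves.KellerYin2024

/-! ## §0 Definitions: the residual pair of `E[p]` over `K` (packaging `LatticeCharacters.lean`),
the Hecke character of a Galois character (ARITHMETIC convention), and "first unit coefficient at `n`" -/

section Defs

variable {p : ℕ} [Fact p.Prime]

/-- **`(θsub, θquot)` is the residual pair of `E[p]` over `K`** (KY §1.4, display (`char to f`),
TeX L1066–1081: "by Ribet's Lemma, from `ρ̄_f^{ss} ≅ 𝔽(φ) ⊕ 𝔽(ψ)` one has an exact sequence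
`0 → 𝔽(φ) → ρ̄_f → 𝔽(ψ) → 0` … which further induces an exact sequence of `Gal(K^Σ/K)`-modules
`0 → M_φ[𝔭] → M_f[𝔭] → M_ψ[𝔭] → 0`, where `φ · ψ = ω`"), for an elliptic curve `WK` over the
number field `K` (here `W.baseChange K`) and two characters `θsub, θquot : Γ_K → GL₁(𝒪)`,
`𝒪 ⊆ ℚ̄_p`: both are TEICHMÜLLER lifts (`θ(σ)^{p−1} = 1`, values in `μ_{p−1} ⊂ ℤ_p^×`: "via the
Teichmüller lift `𝔽^× ↪ 𝓞^×` we view `θ` as taking values in `𝓞^×`", KY L441 / CGLS L493), and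
there is a `Γ_K`-stable subgroup `Φ ≤ E[p](K̄)` of order `p` on which every `σ ∈ Γ_K` acts as
multiplication by an integer `a ≡ θsub(σ) (mod 𝔭)` and such that `σ` acts on `E[p]/Φ` as
multiplication by an integer `b ≡ θquot(σ) (mod 𝔭)` (so `θsub mod 𝔭` is the character of the line,
`θquot mod 𝔭` that of the quotient; for `E/ℚ` with the good-lattice normalisation of `thm308_…`,
`Φ` is the base change of the unique, RAMIFIED, rational line: `θsub = φ = ω̃`, `θquot = ψ = 𝟙̃`).
A DEFINITION — the `∃Φ`-packaging of the tree's per-line predicates `IsTeichmullerLiftOn S Φ θsub`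
("`θsub` is the Teichmüller lift of the character of `Γ_K` on `Φ`") and
`IsTeichmullerLiftOnQuot S Φ E[p] θquot` ("… on `E[p]/Φ`") of `LatticeCharacters.lean` (seat
bsd-eis-k5-c2, whose construction `teichmullerLiftOnQuot` + `isTeichmullerLiftOnQuot_teichmullerLiftOnQuot`
inhabit them), in their announced instantiation `M = geomPoints WK`, `N = Φ`, `T = E[p] = geomTorsion WK p`.
[cite: KellerYin2024, §1.4 display (char to f) (arXiv:2402.12781v2 TeX L1066–1081), §1.1 L441 (Teichmüller lift)]
[cite: CastellaGrossiLeeSkinner2022, Thm. 2.2.2 (hypothesis "E[p]^ss = 𝔽_p(φ) ⊕ 𝔽_p(ψ)") and §1.1 (L490–495)] -/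
def IsResidualPairOver {K : Type} [Field K] (WK : WeierstrassCurve K) (p : ℕ) [Fact p.Prime]
    {S : Set (PadicAlgCl p)} (θsub θquot : FramedGaloisRep K (padicCoeffIntegers S) 1) : Prop :=
  ∃ Φ : AddSubgroup (geomPoints WK), Nat.card Φ = p ∧ Φ ≤ geomTorsion WK (p : ℤ) ∧
    (∀ σ : absoluteGaloisGroup K, ∀ P ∈ Φ, σ • P ∈ Φ) ∧
    IsTeichmullerLiftOn S Φ θsub ∧ IsTeichmullerLiftOnQuot S Φ (geomTorsion WK (p : ℤ)) θquot

/-- Assembling `IsResidualPairOver` from the per-line predicates of `LatticeCharacters.lean` (the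
consumer's glue: `Φ` the base change of the rational line, `θsub`/`θquot` its `teichmullerLiftOnQuot`
constructions). [cite: KellerYin2024, §1.4 display (char to f) (arXiv:2402.12781v2 TeX L1066–1081)] -/
theorem isResidualPairOver_of_isTeichmullerLift {K : Type} [Field K] {WK : WeierstrassCurve K}
    {p : ℕ} [Fact p.Prime] {S : Set (PadicAlgCl p)}
    {θsub θquot : FramedGaloisRep K (padicCoeffIntegers S) 1} {Φ : AddSubgroup (geomPoints WK)}
    (hcard : Nat.card Φ = p) (hle : Φ ≤ geomTorsion WK (p : ℤ))
    (hstab : ∀ σ : absoluteGaloisGroup K, ∀ P ∈ Φ, σ • P ∈ Φ) (hsub : IsTeichmullerLiftOn S Φ θsub)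
    (hquot : IsTeichmullerLiftOnQuot S Φ (geomTorsion WK (p : ℤ)) θquot) :
    IsResidualPairOver WK p θsub θquot :=
  ⟨Φ, hcard, hle, hstab, hsub, hquot⟩

/-- Reading `IsResidualPairOver`: both characters are `(p − 1)`-torsion (Teichmüller lifts).
[cite: KellerYin2024, §1.1 (arXiv:2402.12781v2 TeX L441)] -/
theorem IsResidualPairOver.pow_sub_one {K : Type} [Field K] {WK : WeierstrassCurve K} {p : ℕ}
    [Fact p.Prime] {S : Set (PadicAlgCl p)} {θsub θquot : FramedGaloisRep K (padicCoeffIntegers S) 1}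
    (h : IsResidualPairOver WK p θsub θquot) (σ : absoluteGaloisGroup K) :
    θsub σ ^ (p - 1) = 1 ∧ θquot σ ^ (p - 1) = 1 := by
  obtain ⟨_, _, _, _, hsub, hquot⟩ := h
  exact ⟨hsub.1 σ, hquot.1 σ⟩

/-- **`θK` is the (finite-order) Hecke character of `K` attached to the Galois character
`θ : Γ_K → GL₁(𝒪) ⊂ ℚ̄_p^×` by ARITHMETIC reciprocity, read through `ι : ℚ̄_p ≃ ℂ`**: at every finite
place `w` where `θ` is unramified, `θK` is unramified and `θK(ϖ_w) = ι(θ(Frob_w^{arith}))` (Frobenius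
value via the tree's `FramedGaloisRep.HasFrobCharpolyAt`, Mathlib `IsArithFrobAt`). This is CGLS's
`θ_K` ("the base change of `θ` to `K`", with "`θ(p) = θ_K(ϖ_v)`", "`θ(ℓ)`" the Dirichlet values,
Thm. 2.1.2; the Dirichlet ↔ Galois dictionary `χ(ℓ) = χ(Frob_ℓ^{arith})`). By Chebotarev such a `θK`
is unique. NB: the tree's `IsPAdicAvatarOf ι θK r` uses the GEOMETRIC normalisation
(`r(Frob^{geom}) = ι⁻¹ θK(ϖ)`), under which the avatar of this `θK` is `θ⁻¹`; the Katz `L`-functions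
of `θ` and `θ⁻¹` differ, whence this separate, explicitly arithmetic, predicate.
[cite: CastellaGrossiLeeSkinner2022, Thm. 2.1.2 (θ_K, "θ(p) = θ_K(ϖ_v)"; arXiv:2008.02571v2 TeX L1015–1032) and §1 ("Frob_w … the arithmetic Frobenius")]
[cite: KellerYin2024, §2.1.2 Thm. 2.1.3 (arXiv:2402.12781v2 TeX L1407–1416)] -/
def IsHeckeCharOf {K : Type} [Field K] [NumberField K] (ι : PadicAlgCl p ≃+* ℂ)
    {S : Set (PadicAlgCl p)} (θ : FramedGaloisRep K (padicCoeffIntegers S) 1)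
    (θK : HeckeCharacter K) : Prop :=
  ∀ w : HeightOneSpectrum (𝓞 K), θ.IsUnramifiedAt w →
    θK.IsUnramifiedAt w ∧
      ∀ a : padicCoeffIntegers S, θ.HasFrobCharpolyAt w (X - C a) →
        θK.valueAtUniformizer w = ι (a : PadicAlgCl p)

/-- **"`μ(L) = 0` and `λ(L) = n`" for `L ∈ R₀⟦T⟧ = W(𝔽̄_p)⟦T⟧, coefficientwise**: the `n`-th coefficient
is a unit and all earlier ones are non-units (Weierstrass preparation: `L = unit × distinguished of
degree n`; Washington §7.1, Prop. 7.2 and §13.2) — the inline shape of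
`X1.KellerYinHalves.GoodLatticeMuLambdaOnTree`, named. [cite: Washington1997, §7.1 Prop. 7.2 and §13.2 (μ, λ as first unit coefficient)] -/
def FirstUnitCoeffAt (L : UnrSeries p) (n : ℕ) : Prop :=
  ‖((PowerSeries.coeff n L : unrIntegers p) : ℂ_[p])‖ = 1 ∧
    ∀ i < n, ‖((PowerSeries.coeff i L : unrIntegers p) : ℂ_[p])‖ < 1

/-- Unfolding `FirstUnitCoeffAt`. [cite: Washington1997, §7.1 Prop. 7.2] -/
theorem firstUnitCoeffAt_iff (L : UnrSeries p) (n : ℕ) :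
    FirstUnitCoeffAt L n ↔
      ‖((PowerSeries.coeff n L : unrIntegers p) : ℂ_[p])‖ = 1 ∧
        ∀ i < n, ‖((PowerSeries.coeff i L : unrIntegers p) : ℂ_[p])‖ < 1 :=
  Iff.rfl

/-- The index of the first unit coefficient is unique. [cite: Washington1997, §7.1 Prop. 7.2] -/
theorem FirstUnitCoeffAt.unique {L : UnrSeries p} {m n : ℕ} (hm : FirstUnitCoeffAt L m)
    (hn : FirstUnitCoeffAt L n) : m = n := by
  rcases Nat.lt_trichotomy m n with h | h | h
  · exact absurd hm.1 (ne_of_lt (hn.2 m h))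
  · exact h
  · exact absurd hn.1 (ne_of_lt (hm.2 n h))

end Defs

/-! ## §1 [ALG] Keller–Yin Thm. 1.5.1 (`algmain`) at weight 2 for the good lattice — PREPRINT CLAIM -/

/-- **Keller–Yin, arXiv:2402.12781v2, Thm. 1.5.1 (`algmain`, TeX L1346–1357), SPECIALISED to
weight `2` / the good lattice of an elliptic curve over `ℚ` at a good ANOMALOUS Eisenstein prime —
UNREFEREED PREPRINT CLAIM, typed as a hypothesis by name (`_OPEN`).** As printed: "Assume that
`φ|_{G_p} = ω` and `φ|_{G_K} ≠ ω`. Then the module `𝔛_f` is `Λ`-torsion with `μ(𝔛_f) = 0` and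
`λ(𝔛_f) = λ(𝔛_φ) + λ(𝔛_ψ) + Σ_{w∈S}{λ(𝒫_w(φ)) + λ(𝒫_w(ψ)) − λ(𝒫_w(f))}`. In the case where
`φ|_{G_K} = ω` [⟺ `ψ|_{G_K} = 𝟙`] … `λ(𝔛_f) + 1 = …`." Transcription (module docstring "Dictionary"):
on the data of `thm308_imc2_bdpValue_goodLattice_OPEN` up to `(κ, γ)` (`2 < p`, `Good`, `Red`, `Anom`,
no unramified rational line — KY's "`φ|_{G_p} = ω`" —, `K` with (Heeg) for `N_E` and `p`,
`E(K)[p] = 0`, `ι, v, vbar`, `κ` anticyclotomic, `γ`), for every residual pair `(θsub, θquot)` of `E[p]`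
over `𝒪 = ℤ_p` (`IsResidualPairOver (W/K)`; `θsub = φ|_{G_K} = ω̃`, `θquot = ψ|_{G_K} = 𝟙̃`), the Finset `Sf` of primes of `K`
dividing `N_E`, and ANY `Λ`-duals `Dsub`, `Dquot` of the unramified character Selmer groups
`H¹_{𝓕_nr}(K, M_θ)` of the two restricted characters (p414770): the tree's `𝔛 = AcSelmer.XAc (W/K) p κ
vbar ∅ γ` (CGLS's `𝔛_E`; same `μ`, `λ` as KY's `𝓕_nr`-dual, L1631–1634) is finitely generated and
`Λ`-torsion with `μ(𝔛) = 0` and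
`λ(𝔛) + [ψ|_{G_K} = 𝟙] + Σ_{w∈Sf} λ𝒫_w(f) = λ(Dsub) + λ(Dquot) + Σ_{w∈Sf} (λ𝒫_w(θsub) + λ𝒫_w(θquot))`
(`ℕ`, no subtraction). THIS IS KELLER–YIN'S NEW CONTENT for row A1 (the anomalous algebraic
comparison; CGLS Thm. 1.5.1 is the non-anomalous twin, proof "the same as that of [CGLS, Theorem
1.5.1]" granted KY §§1.1–1.4); the cell's line-by-line audit is HOME/bsd-eis-ky-MEMO-1.md §3A/3A′
(KY's Case-I local row L1202 false but void for non-CM `E`; uniform re-derivation; referee PASS). NEVER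
cite this `Prop` as a theorem. [claim: KellerYin2024, status: under-review]
[cite: KellerYin2024, Thm. 1.5.1 (algmain; arXiv:2402.12781v2 TeX L1346–1357), §1.4 (L1066–1083), §1.5 (L1337–1341), proof of Thm. 3.0.8 (L1631–1634)]
[cite: CastellaGrossiLeeSkinner2022, Thm. 1.5.1 (the non-anomalous twin, shape)] -/
def thm151_algmain_goodLattice_OPEN : Prop :=
  ∀ (W : WeierstrassCurve ℚ) [W.IsElliptic] [W.IsGloballyMinimal] (p : ℕ) [Fact p.Prime],
    2 < p → Good W p → Red W p → Anom W p →
    (∀ Φ : AddSubgroup (geomTorsion W (p : ℤ)), IsRationalLine W p Φ → ¬ LineUnramifiedAt W p Φ) →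
    ∀ (K : Type) [Field K] [NumberField K], IsImaginaryQuadratic K →
      SatisfiesHeegnerHypothesis (W.conductorNorm ℤ) K → SatisfiesHeegnerHypothesis p K →
      (∀ Q : (W.baseChange K).toAffine.Point, p • Q = 0 → Q = 0) →
    ∀ (ι : K →+* ℚ_[p]) (v vbar : HeightOneSpectrum (𝓞 K)),
      (∀ x : 𝓞 K, x ∈ v.asIdeal ↔ ‖ι (x : K)‖ < 1) →
      ((p : ℕ) : 𝓞 K) ∈ vbar.asIdeal → vbar ≠ v →
    ∀ (κ : ZpExtension K p), κ.IsAnticyclotomic →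
    ∀ (γ : absoluteGaloisGroup K) [Fact (κ.IsTopGenerator γ)],
    ∀ (θsub θquot : FramedGaloisRep K (padicCoeffIntegers (∅ : Set (PadicAlgCl p))) 1),
      IsResidualPairOver (W.baseChange K) p θsub θquot →
    ∀ (Sf : Finset (HeightOneSpectrum (𝓞 K))),
      (∀ w : HeightOneSpectrum (𝓞 K), w ∈ Sf ↔ ((W.conductorNorm ℤ : ℤ) : 𝓞 K) ∈ w.asIdeal) →
    ∀ (Dsub : DatumDualData κ γ (charModule ∅ θsub)
        (AcSelmer.bdpData (charModule ∅ θsub) p vbar) ∅)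
      (Dquot : DatumDualData κ γ (charModule ∅ θquot)
        (AcSelmer.bdpData (charModule ∅ θquot) p vbar) ∅),
    Module.Finite (IwasawaAlgebra p) (AcSelmer.XAc (W.baseChange K) p κ vbar ∅ γ) ∧
      Module.IsTorsion (IwasawaAlgebra p) (AcSelmer.XAc (W.baseChange K) p κ vbar ∅ γ) ∧
      muInvariant p (AcSelmer.XAc (W.baseChange K) p κ vbar ∅ γ) = 0 ∧
      lambdaInvariant p (AcSelmer.XAc (W.baseChange K) p κ vbar ∅ γ) +
          (if ∀ σ : absoluteGaloisGroup K, θquot σ = 1 then 1 else 0) +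
          ∑ w ∈ Sf, curveLocalLambda κ (W.baseChange K) w =
        lambdaInvariant p Dsub.X + lambdaInvariant p Dquot.X +
          ∑ w ∈ Sf, (charLocalLambda ∅ κ θsub w + charLocalLambda ∅ κ θquot w)

/-! ## §2 [AN] Castella–Grossi–Lee–Skinner Thm. 2.2.2 with (2.16) — PUBLISHED — and Keller–Yin's
extension to `φ = 𝟙` (Thm. 2.2.2 `anacong`) — PREPRINT CLAIM -/

/-- **Castella–Grossi–Lee–Skinner, Invent. Math. 227 (2022), Thm. 2.2.2 (`cor:Kriz`, arXiv:2008.02571v2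
TeX L1124–1129) WITH the functional-equation identity (2.16) `λ(𝓛_ψ) = λ(𝓛_φ)` of its proof
(L1148–1151) folded in, at the good lattice of an anomalous Eisenstein prime — PUBLISHED.** As printed:
"Assume that `E[p]^{ss} = 𝔽_p(φ) ⊕ 𝔽_p(ψ)` as `G_ℚ`-modules, with the characters `φ, ψ` labeled so
that `p ∤ cond(φ)`, and suppose `φ ≠ 𝟙`. Then `μ(𝓛_E) = 0` and
`λ(𝓛_E) = λ(𝓛_φ) + λ(𝓛_ψ) + Σ_{w∈S}{λ(𝒫_w(φ)) + λ(𝒫_w(ψ)) − λ(𝒫_w(E))}`" (NO hypothesis on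
`φ|_{G_p}`: the anomalous case is INSIDE this theorem); proof: "`μ(𝓛_E) = 0` follows immediately from
the congruence of Theorem 2.2.1 and Hida's result" (so `μ(𝓛_φ) = 0`, Hida 2010) and "(2.16) … the
functional equation for the Katz `p`-adic `L`-function yields `λ(𝓛_ψ) = λ(𝓛_φ)`". Transcription
(module docstring): the data of `thm151_algmain_goodLattice_OPEN` plus (disc) `D_K` odd `≠ −3`, the
newform `Dt.f`, a frame `(ι', Ω_K ≠ 0, Ω_p, L)` with `IsBDPLFunction ι' v κ γ Dt.f Ω_K Ω_p L`
(`𝓛_E`, Castella's normalisation — `μ/λ` currency makes the renormalisation immaterial);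
`φ|_{G_K} := θquot` (the `p`-UNRAMIFIED character) with `φ|_{G_K} ≠ 𝟙` (`¬ ∀ σ, θquot σ = 1`, which
implies the printed `φ ≠ 𝟙`); `θK` the Hecke character of `θquot` (`IsHeckeCharOf`, arithmetic
convention), `Cbar` any finite set of places where `θK` is ramified, and `Lφ` with
`IsKatzLFunction ι' v vbar Cbar κ γ θK Ω_K′ Ω_p′ Lφ` (`𝓛_φ`, with its own period binders
`Ω_K′ ≠ 0`, `Ω_p′ ∈ R₀ˣ` — see the module docstring for why they are not shared with the BDP frame).
Conclusion: `μ(L) = 0 ∧ μ(Lφ) = 0` and `λ(L) + Σ_{w∈Sf} λ𝒫_w(f) = 2·λ(Lφ) + Σ_{w∈Sf} (λ𝒫_w(θsub) +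
λ𝒫_w(θquot))`, in the first-unit-coefficient currency (`FirstUnitCoeffAt`). Covers row A1 "case (b)"
(`𝟙̃ = ε ≠ 𝟙`, 49 census classes). Named fact (D-0014): nothing asserted.
[cite: CastellaGrossiLeeSkinner2022, Thm. 2.2.2 (cor:Kriz) with (2.16) (arXiv:2008.02571v2 TeX L1124–1153); Thm. 2.1.2 (L1015–1041); Thm. 2.1.1]
[cite: Hida2010MuInvariant, Thm. I (μ = 0, as used at CGLS L1132)] [cite: Kriz2016, Thm. 27 (functional equation, as used at CGLS L1148)] -/
def thm222_anacong_goodLattice_of_ne_one : Prop :=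
  ∀ (W : WeierstrassCurve ℚ) [W.IsElliptic] [W.IsGloballyMinimal] (p : ℕ) [Fact p.Prime],
    2 < p → Good W p → Red W p → Anom W p →
    (∀ Φ : AddSubgroup (geomTorsion W (p : ℤ)), IsRationalLine W p Φ → ¬ LineUnramifiedAt W p Φ) →
    ∀ (K : Type) [Field K] [NumberField K], IsImaginaryQuadratic K →
      SatisfiesHeegnerHypothesis (W.conductorNorm ℤ) K → SatisfiesHeegnerHypothesis p K →
      Odd (NumberField.discr K) → NumberField.discr K ≠ -3 →
      (∀ Q : (W.baseChange K).toAffine.Point, p • Q = 0 → Q = 0) →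
    ∀ (ι : K →+* ℚ_[p]) (v vbar : HeightOneSpectrum (𝓞 K)),
      (∀ x : 𝓞 K, x ∈ v.asIdeal ↔ ‖ι (x : K)‖ < 1) →
      ((p : ℕ) : 𝓞 K) ∈ vbar.asIdeal → vbar ≠ v →
    ∀ (κ : ZpExtension K p), κ.IsAnticyclotomic →
    ∀ (γ : absoluteGaloisGroup K) [Fact (κ.IsTopGenerator γ)],
    ∀ (N : ℕ) [NeZero N] (Dt : ModularParametrizationData W N),
    ∀ (ι' : PadicAlgCl p ≃+* ℂ),
      (∀ (w : InfinitePlace K) (k : 𝓞 K), k ∈ v.asIdeal ↔ ‖ι'.symm (w.embedding (k : K))‖ < 1) →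
    ∀ (ΩK : ℂ) (Ωp : (unrIntegers p)ˣ) (L : UnrSeries p), ΩK ≠ 0 →
      IsBDPLFunction ι' v κ γ Dt.f ΩK ((Ωp : unrIntegers p) : ℂ_[p]) L →
    ∀ (θsub θquot : FramedGaloisRep K (padicCoeffIntegers (∅ : Set (PadicAlgCl p))) 1),
      IsResidualPairOver (W.baseChange K) p θsub θquot → (¬ ∀ σ : absoluteGaloisGroup K, θquot σ = 1) →
    ∀ (Sf : Finset (HeightOneSpectrum (𝓞 K))),
      (∀ w : HeightOneSpectrum (𝓞 K), w ∈ Sf ↔ ((W.conductorNorm ℤ : ℤ) : 𝓞 K) ∈ w.asIdeal) →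
    ∀ (θK : HeckeCharacter K), IsHeckeCharOf ι' θquot θK →
    ∀ (Cbar : Finset (HeightOneSpectrum (𝓞 K))), (∀ u ∈ Cbar, ¬ θK.IsUnramifiedAt u) →
    ∀ (ΩK' : ℂ) (Ωp' : (unrIntegers p)ˣ) (Lφ : UnrSeries p), ΩK' ≠ 0 →
      IsKatzLFunction ι' v vbar Cbar κ γ θK ΩK' ((Ωp' : unrIntegers p) : ℂ_[p]) Lφ →
    ∃ n nφ : ℕ, FirstUnitCoeffAt L n ∧ FirstUnitCoeffAt Lφ nφ ∧
      n + ∑ w ∈ Sf, curveLocalLambda κ (W.baseChange K) w =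
        2 * nφ + ∑ w ∈ Sf, (charLocalLambda ∅ κ θsub w + charLocalLambda ∅ κ θquot w)

/-- **Keller–Yin, arXiv:2402.12781v2, Thm. 2.2.2 (`anacong`, TeX L1445–1448) at weight 2 for the good
lattice — the SAME statement as `thm222_anacong_goodLattice_of_ne_one` WITHOUT the hypothesis
`¬ ∀ σ, θquot σ = 1` ("`φ|_{G_K} ≠ 𝟙`") — UNREFEREED PREPRINT CLAIM (`_OPEN`).** As printed: "Assume that `ρ̄_f^{ss} = 𝔽(φ) ⊕ 𝔽(ψ)`
as `G_ℚ`-modules, with the characters `φ`, `ψ` labeled so that `p ∤ cond(φ)`. Then `μ(𝓛_f) = 0` and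
`λ(𝓛_f) = λ(𝓛_φ) + λ(𝓛_ψ) + Σ_{w∈S}{…}`", "combining the above inputs, as in [CGLS]"; the one new
ingredient relative to CGLS Thm. 2.2.2 is KY's remark in the proof of Thm. 2.2.1 (L1426–1427): "If
`φ|_{G_K} = 𝟙`, we would only get partial Eisenstein descent in some cases. However, the proof in
[CGLS] essentially only requires partial Eisenstein descent because only the constant term of `G` …
can be different and the `p`-depletion of `G` does not see the constant term" — an ARGUMENT of the
preprint, load-bearing exactly when `φ = 𝟙̃ = 𝟙`, i.e. `E[p]^{ss} = 𝟙 ⊕ ω` (row A1 "case (a)",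
1 438 of 1 487 type-A census classes). With (2.16) folded in as in the sibling. On `φ ≠ 𝟙` it IS the
sibling (PUB): `thm222_anacong_goodLattice_OPEN.of_ne_one`. NEVER cite this `Prop` as a theorem.
STATUS BY PRIME (ARM P cell `bsd-cited` TY-QUEUE 9; referee C3, `pub/pub-bsdpct/REFEREE.md` R428
OPTION B, 2026-08-27; reader sheet `pub/bsd-cited/sheets/D-AUDIT-r13-Q15-Kriz16-CGLS22.md`
63212b7a93cbaeba): on `5 ≤ p` this statement is a COMPOSITION OF REFEREED PRINT — it is the sibling
`thm222_anacong_goodLattice_of_five_le` below (bridge `thm222_anacong_goodLattice_OPEN.of_five_le`);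
sole unrefereed step at p = 3 (φ = 𝟙): the depletion join f♭ ≡ G♭ feeding (eq:cor-meas) — verified
D-AUDIT-r13-Q15 §4(b), MEMO-1 §3B B3 (i)–(iii), and REFEREE.md R428 §.2(g); flips to PUB-composed on
KY24a VoR. Statement bytes and tags of this declaration unchanged.
[claim: KellerYin2024, status: under-review]
[cite: KellerYin2024, Thm. 2.2.2 (anacong; arXiv:2402.12781v2 TeX L1445–1448) and proof of Thm. 2.2.1 (L1426–1427)]
[cite: CastellaGrossiLeeSkinner2022, Thm. 2.2.2 with (2.16) (the φ ≠ 𝟙 case)] -/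
def thm222_anacong_goodLattice_OPEN : Prop :=
  ∀ (W : WeierstrassCurve ℚ) [W.IsElliptic] [W.IsGloballyMinimal] (p : ℕ) [Fact p.Prime],
    2 < p → Good W p → Red W p → Anom W p →
    (∀ Φ : AddSubgroup (geomTorsion W (p : ℤ)), IsRationalLine W p Φ → ¬ LineUnramifiedAt W p Φ) →
    ∀ (K : Type) [Field K] [NumberField K], IsImaginaryQuadratic K →
      SatisfiesHeegnerHypothesis (W.conductorNorm ℤ) K → SatisfiesHeegnerHypothesis p K →
      Odd (NumberField.discr K) → NumberField.discr K ≠ -3 →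
      (∀ Q : (W.baseChange K).toAffine.Point, p • Q = 0 → Q = 0) →
    ∀ (ι : K →+* ℚ_[p]) (v vbar : HeightOneSpectrum (𝓞 K)),
      (∀ x : 𝓞 K, x ∈ v.asIdeal ↔ ‖ι (x : K)‖ < 1) →
      ((p : ℕ) : 𝓞 K) ∈ vbar.asIdeal → vbar ≠ v →
    ∀ (κ : ZpExtension K p), κ.IsAnticyclotomic →
    ∀ (γ : absoluteGaloisGroup K) [Fact (κ.IsTopGenerator γ)],
    ∀ (N : ℕ) [NeZero N] (Dt : ModularParametrizationData W N),
    ∀ (ι' : PadicAlgCl p ≃+* ℂ),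
      (∀ (w : InfinitePlace K) (k : 𝓞 K), k ∈ v.asIdeal ↔ ‖ι'.symm (w.embedding (k : K))‖ < 1) →
    ∀ (ΩK : ℂ) (Ωp : (unrIntegers p)ˣ) (L : UnrSeries p), ΩK ≠ 0 →
      IsBDPLFunction ι' v κ γ Dt.f ΩK ((Ωp : unrIntegers p) : ℂ_[p]) L →
    ∀ (θsub θquot : FramedGaloisRep K (padicCoeffIntegers (∅ : Set (PadicAlgCl p))) 1),
      IsResidualPairOver (W.baseChange K) p θsub θquot →
    ∀ (Sf : Finset (HeightOneSpectrum (𝓞 K))),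
      (∀ w : HeightOneSpectrum (𝓞 K), w ∈ Sf ↔ ((W.conductorNorm ℤ : ℤ) : 𝓞 K) ∈ w.asIdeal) →
    ∀ (θK : HeckeCharacter K), IsHeckeCharOf ι' θquot θK →
    ∀ (Cbar : Finset (HeightOneSpectrum (𝓞 K))), (∀ u ∈ Cbar, ¬ θK.IsUnramifiedAt u) →
    ∀ (ΩK' : ℂ) (Ωp' : (unrIntegers p)ˣ) (Lφ : UnrSeries p), ΩK' ≠ 0 →
      IsKatzLFunction ι' v vbar Cbar κ γ θK ΩK' ((Ωp' : unrIntegers p) : ℂ_[p]) Lφ →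
    ∃ n nφ : ℕ, FirstUnitCoeffAt L n ∧ FirstUnitCoeffAt Lφ nφ ∧
      n + ∑ w ∈ Sf, curveLocalLambda κ (W.baseChange K) w =
        2 * nφ + ∑ w ∈ Sf, (charLocalLambda ∅ κ θsub w + charLocalLambda ∅ κ θquot w)

/-- The preprint claim CONTAINS the published theorem: dropping the hypothesis `φ ≠ 𝟙` from
CGLS Thm. 2.2.2 is exactly what KY Thm. 2.2.2 asserts (bookkeeping; no content).
[cite: KellerYin2024, Thm. 2.2.2 (arXiv:2402.12781v2 TeX L1445–1448)] [cite: CastellaGrossiLeeSkinner2022, Thm. 2.2.2] -/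
theorem thm222_anacong_goodLattice_OPEN.of_ne_one (h : thm222_anacong_goodLattice_OPEN) :
    thm222_anacong_goodLattice_of_ne_one :=
  fun W _ _ p _ hp hgood hred hanom hlat K _ _ hK hH hHp hodd hd3 htor ι v vbar hv hvbar hne κ hκ γ _
      N _ Dt ι' hι' ΩK Ωp L hΩ hL θsub θquot hpair _ Sf hSf θK hθK Cbar hC ΩK' Ωp' Lφ hΩ' hLφ ↦
    h W p hp hgood hred hanom hlat K hK hH hHp hodd hd3 htor ι v vbar hv hvbar hne κ hκ γ N Dt ι' hι'
      ΩK Ωp L hΩ hL θsub θquot hpair Sf hSf θK hθK Cbar hC ΩK' Ωp' Lφ hΩ' hLφ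

/-! ## §2b [AN] at `5 ≤ p`: CGLS Thm. 2.2.2 with (2.16) ∘ Kriz 2016 (Rem. 33) ∘ Hida 2010 — the
`φ = 𝟙`-inclusive statement as a COMPOSITION OF REFEREED PRINT (ARM P TY-QUEUE 9, C3 R428 OPTION B) -/

/-- **Castella–Grossi–Lee–Skinner 2022 Thms. 2.2.1/2.2.2 with (2.16) ∘ Kriz 2016 (Thm. 35, Thm. 34 (3),
Rem. 33) ∘ Hida 2010: the anomalous-congruence good-lattice ANALYTIC statement WITHOUT «`φ ≠ 𝟙`», at
`5 ≤ p` — COMPOSED OF REFEREED PRINT (ARM P cell `bsd-cited`, TY-QUEUE 9; referee C3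
`pub/pub-bsdpct/REFEREE.md` R428 (ii) OPTION B, 2026-08-27; reader sheet
`pub/bsd-cited/sheets/D-AUDIT-r13-Q15-Kriz16-CGLS22.md` 63212b7a93cbaeba §0/§4(a)/§6; D-AUDIT-r19
cd5ffd83ef1527f9 §F T2).** Statement as in KY Thm. 2.2.2 (arXiv:2402.12781v2 TeX L1445–1448) restricted
to `5 ≤ p`: the body of `thm222_anacong_goodLattice_OPEN` above byte for byte with `2 < p` replaced by
`5 ≤ p` (equivalently: `thm222_anacong_goodLattice_of_ne_one` at `5 ≤ p` minus the binder
`¬ ∀ σ, θquot σ = 1`). WHY THIS IS PRINT: the printed proof of CGLS Thms. 2.2.1/2.2.2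
(arXiv:2008.02571v2 TeX L1051–1153) uses its hypothesis «`φ ≠ 𝟙`» at exactly one line, the congruence
of forms `f ≡ G (mod p)` ((eq:cong-mf), L1075–1078); for `φ = 𝟙` Kriz 2016 Thm. 35 with Thm. 34 (3)
prints partial Eisenstein descent `θf ≡ θG (mod p)` for `E[p]` reducible, and Rem. 33 upgrades it to
FULL descent for weight `k = 2` and `p > k + 1 = 3` (θ-injectivity mod `p` [Serre]; the `N₋N₀ > 1`
sub-case is automatic) — so for `5 ≤ p` (eq:cong-mf) holds as printed and CGLS's proof runs verbatim
(its steps S3–S9 never use «`φ ≠ 𝟙`»; Thm. 2.1.2 Katz factorisation L1015–1041, Hida's `μ = 0` at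
L1132, (2.16) = Kriz Thm. 27 at L1148–1151): pure citation bookkeeping, no unprinted mathematics
(sheet §4(a); C3 R428 (ii) «the p ≥ 5 COMPOSED-PUB word CONFIRMED»). The `p = 3` case is NOT covered
here (full descent can fail at `p = k + 1`; the depletion join is reader-verified only — it stays the
preprint claim `thm222_anacong_goodLattice_OPEN`, see its STATUS sentence). The Kriz tag's depletion
locus records the whole composition family; this declaration uses Rem. 33 only. Bridges (PROVED):
`thm222_anacong_goodLattice_OPEN.of_five_le` (the preprint claim restricts to this) and
`thm222_anacong_goodLattice_of_five_le.of_ne_one` (this implies the published sibling's statement at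
`5 ≤ p`). SCOPE: weight 2, trivial nebentypus, good ordinary anomalous Eisenstein `p ∤ N` — the
[KY24] = arXiv:2402.12781 use only (C2 R328.3(γ)(5); not the arXiv:2410.23241 §3.5 use with nebentypus,
D-AUDIT-r19 ADDENDUM-2 §2b). Census: row A1 «case (a)» classes at `p ≥ 5` (135 of 1 438 by D-AUDIT-r19
ADDENDUM-2 §4; the 1 303 at `p = 3` stay on `_OPEN`). Named fact (D-0014): nothing asserted about `E`;
consumers re-point by their owners (bsd-eis X1).
[cite: CastellaGrossiLeeSkinner2022, Thm. 2.2.1 (thm:kriz) and Thm. 2.2.2 (cor:Kriz) with (2.16), and their proofs (arXiv:2008.02571v2 TeX L1051–1153; measures (eq:def-meas)/(eq:cusp-measure) L989–1003, (eq:Eis-measure) L1082–1088) — the printed hypothesis «φ ≠ 𝟙» enters only at (eq:cong-mf) L1075–1078 and is discharged for φ = 𝟙 as follows]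
[cite: Kriz2016, Thm. 35 and Thm. 34 (3) (partial Eisenstein descent for E[p] reducible), Rem. 33 (full descent automatic for k = 2, p > 3), Def. 31 / Rem. 32 (θ^j f ≡ θ^j E, j ≥ 1), Prop. 37 (with ψ₁ = ψ₂ = 𝟙), Thm. 27 (functional equation), proof of Thm. 3, §4.3 (depletion; the p = 3 case) — ANT 10 (2016) 309–374]
[cite: Hida2010MuInvariant, Thm. I (μ = 0, as used at CGLS L1132)]
[cite: KellerYin2024, Thm. 2.2.2 (anacong; arXiv:2402.12781v2 TeX L1445–1448) — the statement's SHAPE only, restricted to 5 ≤ p; no step of the preprint is used] -/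
def thm222_anacong_goodLattice_of_five_le : Prop :=
  ∀ (W : WeierstrassCurve ℚ) [W.IsElliptic] [W.IsGloballyMinimal] (p : ℕ) [Fact p.Prime],
    5 ≤ p → Good W p → Red W p → Anom W p →
    (∀ Φ : AddSubgroup (geomTorsion W (p : ℤ)), IsRationalLine W p Φ → ¬ LineUnramifiedAt W p Φ) →
    ∀ (K : Type) [Field K] [NumberField K], IsImaginaryQuadratic K →
      SatisfiesHeegnerHypothesis (W.conductorNorm ℤ) K → SatisfiesHeegnerHypothesis p K →
      Odd (NumberField.discr K) → NumberField.discr K ≠ -3 →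
      (∀ Q : (W.baseChange K).toAffine.Point, p • Q = 0 → Q = 0) →
    ∀ (ι : K →+* ℚ_[p]) (v vbar : HeightOneSpectrum (𝓞 K)),
      (∀ x : 𝓞 K, x ∈ v.asIdeal ↔ ‖ι (x : K)‖ < 1) →
      ((p : ℕ) : 𝓞 K) ∈ vbar.asIdeal → vbar ≠ v →
    ∀ (κ : ZpExtension K p), κ.IsAnticyclotomic →
    ∀ (γ : absoluteGaloisGroup K) [Fact (κ.IsTopGenerator γ)],
    ∀ (N : ℕ) [NeZero N] (Dt : ModularParametrizationData W N),
    ∀ (ι' : PadicAlgCl p ≃+* ℂ),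
      (∀ (w : InfinitePlace K) (k : 𝓞 K), k ∈ v.asIdeal ↔ ‖ι'.symm (w.embedding (k : K))‖ < 1) →
    ∀ (ΩK : ℂ) (Ωp : (unrIntegers p)ˣ) (L : UnrSeries p), ΩK ≠ 0 →
      IsBDPLFunction ι' v κ γ Dt.f ΩK ((Ωp : unrIntegers p) : ℂ_[p]) L →
    ∀ (θsub θquot : FramedGaloisRep K (padicCoeffIntegers (∅ : Set (PadicAlgCl p))) 1),
      IsResidualPairOver (W.baseChange K) p θsub θquot →
    ∀ (Sf : Finset (HeightOneSpectrum (𝓞 K))),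
      (∀ w : HeightOneSpectrum (𝓞 K), w ∈ Sf ↔ ((W.conductorNorm ℤ : ℤ) : 𝓞 K) ∈ w.asIdeal) →
    ∀ (θK : HeckeCharacter K), IsHeckeCharOf ι' θquot θK →
    ∀ (Cbar : Finset (HeightOneSpectrum (𝓞 K))), (∀ u ∈ Cbar, ¬ θK.IsUnramifiedAt u) →
    ∀ (ΩK' : ℂ) (Ωp' : (unrIntegers p)ˣ) (Lφ : UnrSeries p), ΩK' ≠ 0 →
      IsKatzLFunction ι' v vbar Cbar κ γ θK ΩK' ((Ωp' : unrIntegers p) : ℂ_[p]) Lφ →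
    ∃ n nφ : ℕ, FirstUnitCoeffAt L n ∧ FirstUnitCoeffAt Lφ nφ ∧
      n + ∑ w ∈ Sf, curveLocalLambda κ (W.baseChange K) w =
        2 * nφ + ∑ w ∈ Sf, (charLocalLambda ∅ κ θsub w + charLocalLambda ∅ κ θquot w)

/-- **Bridge 1, PROVED (restriction, bookkeeping)**: the preprint claim at every odd `p` implies its
`5 ≤ p` slice. [cite: KellerYin2024, Thm. 2.2.2 (arXiv:2402.12781v2 TeX L1445–1448)]
[cite: CastellaGrossiLeeSkinner2022, Thm. 2.2.2 with (2.16)] -/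
theorem thm222_anacong_goodLattice_OPEN.of_five_le (h : thm222_anacong_goodLattice_OPEN) :
    thm222_anacong_goodLattice_of_five_le :=
  fun W _ _ p _ hp hgood hred hanom hlat K _ _ hK hH hHp hodd hd3 htor ι v vbar hv hvbar hne κ hκ γ _
      N _ Dt ι' hι' ΩK Ωp L hΩ hL θsub θquot hpair Sf hSf θK hθK Cbar hC ΩK' Ωp' Lφ hΩ' hLφ ↦
    h W p (lt_of_lt_of_le (by norm_num) hp) hgood hred hanom hlat K hK hH hHp hodd hd3 htor ι v vbar hv
      hvbar hne κ hκ γ N Dt ι' hι' ΩK Ωp L hΩ hL θsub θquot hpair Sf hSf θK hθK Cbar hC ΩK' Ωp' Lφ hΩ' hLφ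

/-- **Bridge 2, PROVED (bookkeeping)**: the `5 ≤ p` composed-print statement implies the PUBLISHED
sibling `thm222_anacong_goodLattice_of_ne_one` restricted to `5 ≤ p` (the extra hypothesis
«`φ|_{G_K} ≠ 𝟙`» is discarded) — stated here in full because the sibling carries `2 < p`.
[cite: CastellaGrossiLeeSkinner2022, Thm. 2.2.2 (cor:Kriz) with (2.16) (arXiv:2008.02571v2 TeX L1124–1153)]
[cite: Kriz2016, Rem. 33 (full Eisenstein descent for k = 2, p > 3)] -/
theorem thm222_anacong_goodLattice_of_five_le.of_ne_one (h : thm222_anacong_goodLattice_of_five_le) :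
    ∀ (W : WeierstrassCurve ℚ) [W.IsElliptic] [W.IsGloballyMinimal] (p : ℕ) [Fact p.Prime],
      5 ≤ p → Good W p → Red W p → Anom W p →
      (∀ Φ : AddSubgroup (geomTorsion W (p : ℤ)), IsRationalLine W p Φ → ¬ LineUnramifiedAt W p Φ) →
      ∀ (K : Type) [Field K] [NumberField K], IsImaginaryQuadratic K →
        SatisfiesHeegnerHypothesis (W.conductorNorm ℤ) K → SatisfiesHeegnerHypothesis p K →
        Odd (NumberField.discr K) → NumberField.discr K ≠ -3 →
        (∀ Q : (W.baseChange K).toAffine.Point, p • Q = 0 → Q = 0) →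
      ∀ (ι : K →+* ℚ_[p]) (v vbar : HeightOneSpectrum (𝓞 K)),
        (∀ x : 𝓞 K, x ∈ v.asIdeal ↔ ‖ι (x : K)‖ < 1) →
        ((p : ℕ) : 𝓞 K) ∈ vbar.asIdeal → vbar ≠ v →
      ∀ (κ : ZpExtension K p), κ.IsAnticyclotomic →
      ∀ (γ : absoluteGaloisGroup K) [Fact (κ.IsTopGenerator γ)],
      ∀ (N : ℕ) [NeZero N] (Dt : ModularParametrizationData W N),
      ∀ (ι' : PadicAlgCl p ≃+* ℂ),
        (∀ (w : InfinitePlace K) (k : 𝓞 K), k ∈ v.asIdeal ↔ ‖ι'.symm (w.embedding (k : K))‖ < 1) →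
      ∀ (ΩK : ℂ) (Ωp : (unrIntegers p)ˣ) (L : UnrSeries p), ΩK ≠ 0 →
        IsBDPLFunction ι' v κ γ Dt.f ΩK ((Ωp : unrIntegers p) : ℂ_[p]) L →
      ∀ (θsub θquot : FramedGaloisRep K (padicCoeffIntegers (∅ : Set (PadicAlgCl p))) 1),
        IsResidualPairOver (W.baseChange K) p θsub θquot → (¬ ∀ σ : absoluteGaloisGroup K, θquot σ = 1) →
      ∀ (Sf : Finset (HeightOneSpectrum (𝓞 K))),
        (∀ w : HeightOneSpectrum (𝓞 K), w ∈ Sf ↔ ((W.conductorNorm ℤ : ℤ) : 𝓞 K) ∈ w.asIdeal) →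
      ∀ (θK : HeckeCharacter K), IsHeckeCharOf ι' θquot θK →
      ∀ (Cbar : Finset (HeightOneSpectrum (𝓞 K))), (∀ u ∈ Cbar, ¬ θK.IsUnramifiedAt u) →
      ∀ (ΩK' : ℂ) (Ωp' : (unrIntegers p)ˣ) (Lφ : UnrSeries p), ΩK' ≠ 0 →
        IsKatzLFunction ι' v vbar Cbar κ γ θK ΩK' ((Ωp' : unrIntegers p) : ℂ_[p]) Lφ →
      ∃ n nφ : ℕ, FirstUnitCoeffAt L n ∧ FirstUnitCoeffAt Lφ nφ ∧
        n + ∑ w ∈ Sf, curveLocalLambda κ (W.baseChange K) w =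
          2 * nφ + ∑ w ∈ Sf, (charLocalLambda ∅ κ θsub w + charLocalLambda ∅ κ θquot w) :=
  fun W _ _ p _ hp hgood hred hanom hlat K _ _ hK hH hHp hodd hd3 htor ι v vbar hv hvbar hne κ hκ γ _
      N _ Dt ι' hι' ΩK Ωp L hΩ hL θsub θquot hpair _ Sf hSf θK hθK Cbar hC ΩK' Ωp' Lφ hΩ' hLφ ↦
    h W p hp hgood hred hanom hlat K hK hH hHp hodd hd3 htor ι v vbar hv hvbar hne κ hκ γ N Dt ι' hι'
      ΩK Ωp L hΩ hL θsub θquot hpair Sf hSf θK hθK Cbar hC ΩK' Ωp' Lφ hΩ' hLφ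

/-- **The typed shape of the `λ`-comparison the consumer needs**, as a PROVED lemma of pure
arithmetic (no fact): from [ALG]'s identity `λX + e + Σf = λ₁ + λ₂ + Σθ`, [AN]'s identity
`n + Σf = 2 nφ + Σθ` and bridge identities `λ₁ = nφ`, `λ₂ = nφ + e` ([BR], to be supplied by the
consumer), one gets `λX = n`. The `+1` of KY's second case (`e = 1`, `ψ|_{G_K} = 𝟙`) cancels against
Yager's `λ(𝔛_𝟙) = λ(𝓛_𝟙) + 1` exactly as in KY's proof of Thm. 2.2.3 (L1464–1467).
[cite: KellerYin2024, proof of Thm. 2.2.3 (arXiv:2402.12781v2 TeX L1455–1467)] -/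
theorem lambda_eq_of_alg_of_an_of_bridge {lamX lam1 lam2 n nφ e Sf Sθ : ℕ}
    (halg : lamX + e + Sf = lam1 + lam2 + Sθ) (han : n + Sf = 2 * nφ + Sθ)
    (hbr1 : lam1 = nφ) (hbr2 : lam2 = nφ + e) : lamX = n := by
  subst hbr1 hbr2
  omega

end Literature.NumberTheory.EllipticCurves.KellerYin2024

end
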